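import Mathlib
import Summits.NavierStokesRegularity.NavierStokesRegularity.Theorems.OrthantWakeOrthantTableStructure
import Summits.NavierStokesRegularity.NavierStokesRegularity.Theorems.SubcriticalEnvelopeForwardSourceSmoothingFlux
import HarnessLib

/-!
# `SubcriticalEnvelope.ForwardSourceTailEnvelopeKP` (stmt-NavierStokesRegularity-27130) — the NORMAL
FORM of KP networks proper (helper file, `--supports`)

The three KP-class cruxes of the TL-M2Break cluster (27057 `ForwardTailCeilingKP`, 27130
`ForwardSourceTailEnvelopeKP`, parked 26999 `KPBlockWake`) quantify over the tables `α ∈ E₂(R)`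
(symmetric (4.2), cancelling (4.3), comparable) that are ORTHANT (Kamke quasi-positivity of the
nonlinearity on the cone `{Y ≥ 0 on shells ≥ 1}`, quantified over all families) and have DIAGONAL
inter-shell feed forms (`α a b i (0,0,1) = 0` for `a ≠ b`).  This file turns those four clauses into
the CLOSED FORM of the class's equations of motion — step 0 of any argument on the general class
(LEAD SOC census v4 (iv): «general KP networks proper … needs an energy/flux ingredient»):

* `kpProper_up1_diag`, `kpProper_up2_diag` — (4.2)–(4.3) alone: the diagonal back-reactions of a feed
  `x_q² → x_p'` are `α p q q (1,0,0) = α q p q (0,1,0) = −α q q p (0,0,1)/2` (Katz–Pavlović pairs);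
* `kpProper_up1_offDiag`, `kpProper_up2_offDiag` — with the orthant and diagonal clauses: every
  OTHER two-shell coefficient vanishes (`α p q r (1,0,0) = 0` for `q ≠ r`, `α p q r (0,1,0) = 0` for
  `p ≠ r`): (4.2)–(4.3) make such a triad a rotor inside the lower shell catalysed by the upper
  amplitude, and an orthant table has no rotors (ow-p1's `orthant_iff_coefficients`, clause (2));
* `kpProper_feed_nonneg` — the feed weights `w_{ai} := α a a i (0,0,1)` are `≥ 0` (clause (1));
* `kpProper_quadTerm` — THE NORMAL FORM: for every family `X`,
  `quadTerm ε₀ α X i n = (1+ε₀)^{5(n-1)/2} Σ_a w_{ai} X_{a,n-1}² − (1+ε₀)^{5n/2} X_{i,n} Σ_j w_{ij} X_{j,n+1}`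
  `+ (1+ε₀)^{5n/2} Σ_{a,b} α a b i (0,0,0) X_{a,n} X_{b,n}`:
  the cross-shell dynamics of a KP network proper is a non-negative combination of Katz–Pavlović
  feeds `x_{a,k}² → x_{i,k+1}` — nothing else — plus an in-shell quadratic coupling (copositive and
  cancelling; NOT only in-shell KP pumps: differential in-shell pumps `(y_a − y_b)² → y_c` with
  asymmetric returns are admissible);
* `kpProper_shellEnergy_identity` — pairing with `X_{·,n}`: the in-shell coupling moves no shell
  energy (`forwardSourceSmoothing_inShell_DDD_eq_zero`), so `Σ_i X_{i,n}·quadTerm_i = IN_n − OUT_n`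
  with `IN_n = (1+ε₀)^{5(n-1)/2} Σ_{a,i} w_{ai} X_{a,n-1}² X_{i,n}` and `OUT_n = IN_{n+1}`: the shell
  energies of a KP network proper form a conservative nearest-neighbour FLUX CHAIN whose bond fluxes
  are the feed fluxes (signed by the receiving amplitudes only).

Consequences recorded for the census: the syntactic forward sources are `S⁺(α) = {a : ∃ i, w_{ai} ≠ 0}`;
a non-source component has no cross-shell drain (its amplitude changes only in-shell and by
viscosity); the permutation networks `kpPermTable σ c` (p638990) are the case `w = ` permutation
matrix `· diag(c)` with no in-shell part.

HONEST FRAMING: algebra about Tao-type MODEL lattice tables (rung TL-M2Break); no crux is proved or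
refuted; nothing here concerns the Navier–Stokes equations; NS regularity is NOT advanced.
-/

noncomputable section

-- the sub-problem namespace `NavierStokesRegularity.NavierStokesRegularity` is the tree's layout (D-0017)
set_option linter.dupNamespace false

namespace Summit.NavierStokesRegularity.NavierStokesRegularity.Theorems

open Finset
open Literature.Analysis.FluidPDE.TaoCascade

variable {α : Fin 4 → Fin 4 → Fin 4 → ℤ × ℤ × ℤ → ℝ}

/-- The feed shift `(0,0,1)` belongs to Tao's shift set. [cite: Tao2016AveragedNS, §4 after (4.1)] -/
theorem kpProper_mem001 : ((0 : ℤ), (0 : ℤ), (1 : ℤ)) ∈ shiftSet :=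
  (mem_shiftSet_iff _).2 (Or.inr (Or.inr (Or.inr rfl)))

/-- The shift `(1,0,0)` belongs to Tao's shift set. [cite: Tao2016AveragedNS, §4 after (4.1)] -/
theorem kpProper_mem100 : ((1 : ℤ), (0 : ℤ), (0 : ℤ)) ∈ shiftSet :=
  (mem_shiftSet_iff _).2 (Or.inr (Or.inl rfl))

/-- The shift `(0,1,0)` belongs to Tao's shift set. [cite: Tao2016AveragedNS, §4 after (4.1)] -/
theorem kpProper_mem010 : ((0 : ℤ), (1 : ℤ), (0 : ℤ)) ∈ shiftSet :=
  (mem_shiftSet_iff _).2 (Or.inr (Or.inr (Or.inl rfl)))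

/-! ## §1 The two-shell coefficients -/

/-- **Katz–Pavlović back-reaction, first slot** ((4.2)–(4.3) only): `α p q q (1,0,0) = −α q q p (0,0,1)/2`
— the feed `x_q² → x_p'` one shell up drains `x_q` through `−(w/2)·x_p x_q` twice.
[cite: Tao2016AveragedNS, §4 (4.2)–(4.3)] -/
theorem kpProper_up1_diag (hs : IsSymmetricCoeff α) (hc : IsCancellingCoeff α) (p q : Fin 4) :
    α p q q (1, 0, 0) = -(α q q p (0, 0, 1)) / 2 := by
  have h := hc q q p 0 0 1 kpProper_mem001
  have h1 : α q p q (0, 1, 0) = α p q q (1, 0, 0) := hs q p q 0 1 0 kpProper_mem010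
  linarith

/-- **Katz–Pavlović back-reaction, second slot**: `α q p q (0,1,0) = −α q q p (0,0,1)/2`.
[cite: Tao2016AveragedNS, §4 (4.2)–(4.3)] -/
theorem kpProper_up2_diag (hs : IsSymmetricCoeff α) (hc : IsCancellingCoeff α) (p q : Fin 4) :
    α q p q (0, 1, 0) = -(α q q p (0, 0, 1)) / 2 := by
  rw [hs q p q 0 1 0 kpProper_mem010, kpProper_up1_diag hs hc]

/-- **No catalysed rotors in a KP network proper**: for `q ≠ r`, `α p q r (1,0,0) = 0`.  With the
diagonal clause the two `(0,0,1)` members of the cancellation orbit vanish, (4.2) folds the rest into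
`α p q r (1,0,0) + α p r q (1,0,0) = 0` (a rotor between `x_q` and `x_r` catalysed by the upper
amplitude `x_p`), and the orthant clause (cross back-reactions `≥ 0`) kills both. [this file] -/
theorem kpProper_up1_offDiag (hs : IsSymmetricCoeff α) (hc : IsCancellingCoeff α)
    (hO : ∀ (Y : Fin 4 → ℤ → ℝ → ℝ) (τ : ℝ), (∀ (j : Fin 4) (k : ℤ), 1 ≤ k → 0 ≤ Y j k τ) →
      ∀ δ : ℝ, 0 < δ → ∀ (i : Fin 4) (n : ℤ), 1 ≤ n → Y i n τ = 0 → 0 ≤ quadTerm δ α Y i n τ)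
    (hD : ∀ a b i : Fin 4, a ≠ b → α a b i (0, 0, 1) = 0) {p q r : Fin 4} (hqr : q ≠ r) :
    α p q r (1, 0, 0) = 0 := by
  obtain ⟨_, h2, _⟩ := (orthant_iff_coefficients α).1 hO
  have h := hc p q r 1 0 0 kpProper_mem100
  rw [hD q r p hqr, hD r q p (Ne.symm hqr), hs q p r 0 1 0 kpProper_mem010, hs r p q 0 1 0 kpProper_mem010] at h
  have ha : 0 ≤ α p q r (1, 0, 0) := by
    have := h2 r p q hqr
    rwa [hs q p r 0 1 0 kpProper_mem010, ← two_mul, mul_nonneg_iff_of_pos_left two_pos] at this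
  have hb : 0 ≤ α p r q (1, 0, 0) := by
    have := h2 q p r (Ne.symm hqr)
    rwa [hs r p q 0 1 0 kpProper_mem010, ← two_mul, mul_nonneg_iff_of_pos_left two_pos] at this
  linarith

/-- The same for the second slot: for `p ≠ r`, `α p q r (0,1,0) = 0`. [this file] -/
theorem kpProper_up2_offDiag (hs : IsSymmetricCoeff α) (hc : IsCancellingCoeff α)
    (hO : ∀ (Y : Fin 4 → ℤ → ℝ → ℝ) (τ : ℝ), (∀ (j : Fin 4) (k : ℤ), 1 ≤ k → 0 ≤ Y j k τ) →
      ∀ δ : ℝ, 0 < δ → ∀ (i : Fin 4) (n : ℤ), 1 ≤ n → Y i n τ = 0 → 0 ≤ quadTerm δ α Y i n τ)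
    (hD : ∀ a b i : Fin 4, a ≠ b → α a b i (0, 0, 1) = 0) {p q r : Fin 4} (hpr : p ≠ r) :
    α p q r (0, 1, 0) = 0 := by
  rw [hs p q r 0 1 0 kpProper_mem010, kpProper_up1_offDiag hs hc hO hD hpr]

/-- **Feed weights are non-negative**: `0 ≤ w_{ai} = α a a i (0,0,1)` for an orthant table (clause (1)
of `orthant_iff_coefficients` at the coordinate vector `e_a`). [this file] -/
theorem kpProper_feed_nonneg
    (hO : ∀ (Y : Fin 4 → ℤ → ℝ → ℝ) (τ : ℝ), (∀ (j : Fin 4) (k : ℤ), 1 ≤ k → 0 ≤ Y j k τ) →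
      ∀ δ : ℝ, 0 < δ → ∀ (i : Fin 4) (n : ℤ), 1 ≤ n → Y i n τ = 0 → 0 ≤ quadTerm δ α Y i n τ)
    (a i : Fin 4) : 0 ≤ α a a i (0, 0, 1) := by
  obtain ⟨h1, _, _⟩ := (orthant_iff_coefficients α).1 hO
  have h := h1 i (Pi.single a 1)
  rw [Finset.sum_eq_single a, Finset.sum_eq_single a] at h
  · simpa using h
  · intro b _ hb; simp [hb]
  · intro h'; exact absurd (Finset.mem_univ a) h'
  · intro b _ hb
    exact Finset.sum_eq_zero fun j _ => by simp [Pi.single_apply, hb]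
  · intro h'; exact absurd (Finset.mem_univ a) h'

/-! ## §2 The normal form of the nonlinearity -/

/-- **NORMAL FORM OF A KP NETWORK PROPER.**  For a symmetric, cancelling, orthant table with diagonal
feed forms and ANY family `X`:
`quadTerm ε₀ α X i n t = (1+ε₀)^{5(n-1)/2}·Σ_a α a a i (0,0,1)·X_{a,n-1}²`
`  − (1+ε₀)^{5n/2}·X_{i,n}·Σ_j α i i j (0,0,1)·X_{j,n+1} + (1+ε₀)^{5n/2}·Σ_{a,b} α a b i (0,0,0)·X_{a,n}X_{b,n}`.
MODEL lattice algebra. [this file] -/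
theorem kpProper_quadTerm (hs : IsSymmetricCoeff α) (hc : IsCancellingCoeff α)
    (hO : ∀ (Y : Fin 4 → ℤ → ℝ → ℝ) (τ : ℝ), (∀ (j : Fin 4) (k : ℤ), 1 ≤ k → 0 ≤ Y j k τ) →
      ∀ δ : ℝ, 0 < δ → ∀ (i : Fin 4) (n : ℤ), 1 ≤ n → Y i n τ = 0 → 0 ≤ quadTerm δ α Y i n τ)
    (hD : ∀ a b i : Fin 4, a ≠ b → α a b i (0, 0, 1) = 0)
    (ε₀ : ℝ) (X : Fin 4 → ℤ → ℝ → ℝ) (i : Fin 4) (n : ℤ) (t : ℝ) :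
    quadTerm ε₀ α X i n t =
      (1 + ε₀) ^ ((5 : ℝ) * ((n : ℝ) - 1) / 2) * ∑ a, α a a i (0, 0, 1) * X a (n - 1) t ^ 2 -
        (1 + ε₀) ^ ((5 : ℝ) * n / 2) * (X i n t * ∑ j, α i i j (0, 0, 1) * X j (n + 1) t) +
        (1 + ε₀) ^ ((5 : ℝ) * n / 2) * ∑ a, ∑ b, α a b i (0, 0, 0) * (X a n t * X b n t) := by
  rw [quadTerm_four_shifts]
  -- the feed block: only the diagonal survives
  have hfeed : ∑ i₁, ∑ i₂, α i₁ i₂ i (0, 0, 1) * (X i₁ (n - 1) t * X i₂ (n - 1) t) =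
      ∑ a, α a a i (0, 0, 1) * X a (n - 1) t ^ 2 := by
    refine Finset.sum_congr rfl fun a _ => ?_
    rw [Finset.sum_eq_single a]
    · ring
    · intro b _ hb; rw [hD a b i (Ne.symm hb), zero_mul]
    · intro h'; exact absurd (Finset.mem_univ a) h'
  -- the (1,0,0) block: only `i₂ = i` survives, with the KP back-reaction
  have hup1 : ∑ i₁, ∑ i₂, α i₁ i₂ i (1, 0, 0) * (X i₁ (n + 1) t * X i₂ n t) =
      ∑ j, -(α i i j (0, 0, 1)) / 2 * (X j (n + 1) t * X i n t) := by
    refine Finset.sum_congr rfl fun j _ => ?_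
    rw [Finset.sum_eq_single i]
    · rw [kpProper_up1_diag hs hc]
    · intro b _ hb; rw [kpProper_up1_offDiag hs hc hO hD hb, zero_mul]
    · intro h'; exact absurd (Finset.mem_univ i) h'
  -- the (0,1,0) block: only `i₁ = i` survives
  have hup2 : ∑ i₁, ∑ i₂, α i₁ i₂ i (0, 1, 0) * (X i₁ n t * X i₂ (n + 1) t) =
      ∑ j, -(α i i j (0, 0, 1)) / 2 * (X i n t * X j (n + 1) t) := by
    rw [Finset.sum_eq_single i]
    · refine Finset.sum_congr rfl fun j _ => ?_
      rw [kpProper_up2_diag hs hc]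
    · intro b _ hb
      exact Finset.sum_eq_zero fun j _ => by rw [kpProper_up2_offDiag hs hc hO hD hb, zero_mul]
    · intro h'; exact absurd (Finset.mem_univ i) h'
  have hsplit : ∑ i₁, ∑ i₂, (α i₁ i₂ i (0, 0, 0) * (X i₁ n t * X i₂ n t) +
      α i₁ i₂ i (1, 0, 0) * (X i₁ (n + 1) t * X i₂ n t) +
      α i₁ i₂ i (0, 1, 0) * (X i₁ n t * X i₂ (n + 1) t)) =
      ∑ i₁, ∑ i₂, α i₁ i₂ i (0, 0, 0) * (X i₁ n t * X i₂ n t) +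
      ∑ i₁, ∑ i₂, α i₁ i₂ i (1, 0, 0) * (X i₁ (n + 1) t * X i₂ n t) +
      ∑ i₁, ∑ i₂, α i₁ i₂ i (0, 1, 0) * (X i₁ n t * X i₂ (n + 1) t) := by
    simp only [Finset.sum_add_distrib]
  rw [hsplit, hfeed, hup1, hup2]
  have hdrain : ∑ j, -(α i i j (0, 0, 1)) / 2 * (X j (n + 1) t * X i n t) +
      ∑ j, -(α i i j (0, 0, 1)) / 2 * (X i n t * X j (n + 1) t) =
      -(X i n t * ∑ j, α i i j (0, 0, 1) * X j (n + 1) t) := by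
    rw [Finset.mul_sum, ← Finset.sum_add_distrib, ← Finset.sum_neg_distrib]
    exact Finset.sum_congr rfl fun j _ => by ring
  rw [add_assoc, hdrain]
  ring

/-- **A component that feeds nothing has no cross-shell drain.**  If `α i i j (0,0,1) = 0` for all `j`
(component `i` is not a forward source), its nonlinearity is the in-feed plus the in-shell coupling.
[this file] -/
theorem kpProper_quadTerm_nonSource (hs : IsSymmetricCoeff α) (hc : IsCancellingCoeff α)
    (hO : ∀ (Y : Fin 4 → ℤ → ℝ → ℝ) (τ : ℝ), (∀ (j : Fin 4) (k : ℤ), 1 ≤ k → 0 ≤ Y j k τ) →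
      ∀ δ : ℝ, 0 < δ → ∀ (i : Fin 4) (n : ℤ), 1 ≤ n → Y i n τ = 0 → 0 ≤ quadTerm δ α Y i n τ)
    (hD : ∀ a b i : Fin 4, a ≠ b → α a b i (0, 0, 1) = 0)
    {i : Fin 4} (hi : ∀ j, α i i j (0, 0, 1) = 0)
    (ε₀ : ℝ) (X : Fin 4 → ℤ → ℝ → ℝ) (n : ℤ) (t : ℝ) :
    quadTerm ε₀ α X i n t =
      (1 + ε₀) ^ ((5 : ℝ) * ((n : ℝ) - 1) / 2) * ∑ a, α a a i (0, 0, 1) * X a (n - 1) t ^ 2 +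
        (1 + ε₀) ^ ((5 : ℝ) * n / 2) * ∑ a, ∑ b, α a b i (0, 0, 0) * (X a n t * X b n t) := by
  rw [kpProper_quadTerm hs hc hO hD]
  simp [hi]

/-! ## §3 The shell-energy flux chain -/

/-- **Shell-energy identity of a KP network proper.**  Pairing the normal form with the shell
amplitudes: the in-shell coupling moves no shell energy ((4.3): `forwardSourceSmoothing_inShell_DDD_eq_zero`
with `D = univ`), so `Σ_i X_{i,n}·quadTerm_i = IN_n − OUT_n` with the FEED FLUXES
`IN_n = (1+ε₀)^{5(n-1)/2} Σ_i Σ_a w_{ai} X_{a,n-1}² X_{i,n}` and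
`OUT_n = (1+ε₀)^{5n/2} Σ_i Σ_j w_{ij} X_{i,n}² X_{j,n+1}` (`= IN_{n+1}` after renaming): along any
solution `d/dt ½|X_n|² = IN_n − OUT_n − ν(1+ε₀)^{2n}|X_n|²`, a conservative nearest-neighbour flux
chain whose bond fluxes carry the sign of the RECEIVING amplitudes only. MODEL lattice algebra.
[this file] -/
theorem kpProper_shellEnergy_identity (hs : IsSymmetricCoeff α) (hc : IsCancellingCoeff α)
    (hO : ∀ (Y : Fin 4 → ℤ → ℝ → ℝ) (τ : ℝ), (∀ (j : Fin 4) (k : ℤ), 1 ≤ k → 0 ≤ Y j k τ) →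
      ∀ δ : ℝ, 0 < δ → ∀ (i : Fin 4) (n : ℤ), 1 ≤ n → Y i n τ = 0 → 0 ≤ quadTerm δ α Y i n τ)
    (hD : ∀ a b i : Fin 4, a ≠ b → α a b i (0, 0, 1) = 0)
    (ε₀ : ℝ) (X : Fin 4 → ℤ → ℝ → ℝ) (n : ℤ) (t : ℝ) :
    ∑ i, X i n t * quadTerm ε₀ α X i n t =
      (1 + ε₀) ^ ((5 : ℝ) * ((n : ℝ) - 1) / 2) * ∑ i, ∑ a, α a a i (0, 0, 1) * X a (n - 1) t ^ 2 * X i n t -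
        (1 + ε₀) ^ ((5 : ℝ) * n / 2) * ∑ i, ∑ j, α i i j (0, 0, 1) * X i n t ^ 2 * X j (n + 1) t := by
  set L1 : ℝ := (1 + ε₀) ^ ((5 : ℝ) * ((n : ℝ) - 1) / 2) with hL1
  set L0 : ℝ := (1 + ε₀) ^ ((5 : ℝ) * n / 2) with hL0
  have hin : ∑ i, X i n t * ∑ a, ∑ b, α a b i (0, 0, 0) * (X a n t * X b n t) = 0 := by
    have h := forwardSourceSmoothing_inShell_DDD_eq_zero hc Finset.univ (fun a => X a n t)
    simpa [Finset.mul_sum] using h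
  have hexp : ∀ i, X i n t * quadTerm ε₀ α X i n t =
      L1 * ∑ a, α a a i (0, 0, 1) * X a (n - 1) t ^ 2 * X i n t -
      L0 * ∑ j, α i i j (0, 0, 1) * X i n t ^ 2 * X j (n + 1) t +
      L0 * (X i n t * ∑ a, ∑ b, α a b i (0, 0, 0) * (X a n t * X b n t)) := by
    intro i
    rw [kpProper_quadTerm hs hc hO hD]
    have eA : X i n t * (L1 * ∑ a, α a a i (0, 0, 1) * X a (n - 1) t ^ 2) =
        L1 * ∑ a, α a a i (0, 0, 1) * X a (n - 1) t ^ 2 * X i n t := by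
      simp only [Finset.mul_sum]
      exact Finset.sum_congr rfl fun a _ => by ring
    have eB : X i n t * (L0 * (X i n t * ∑ j, α i i j (0, 0, 1) * X j (n + 1) t)) =
        L0 * ∑ j, α i i j (0, 0, 1) * X i n t ^ 2 * X j (n + 1) t := by
      simp only [Finset.mul_sum]
      exact Finset.sum_congr rfl fun j _ => by ring
    have eC : X i n t * (L0 * ∑ a, ∑ b, α a b i (0, 0, 0) * (X a n t * X b n t)) =
        L0 * (X i n t * ∑ a, ∑ b, α a b i (0, 0, 0) * (X a n t * X b n t)) := by ring
    rw [mul_add, mul_sub, eA, eB, eC]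
  rw [Finset.sum_congr rfl fun i _ => hexp i, Finset.sum_add_distrib, Finset.sum_sub_distrib,
    ← Finset.mul_sum, ← Finset.mul_sum, ← Finset.mul_sum, hin, mul_zero, add_zero]

/-- **The bond fluxes telescope**: the out-flux of shell `n` is the in-flux of shell `n + 1` (the same
double sum after renaming the indices and the shell). [this file] -/
theorem kpProper_outFlux_eq_inFlux_succ (ε₀ : ℝ) (X : Fin 4 → ℤ → ℝ → ℝ) (n : ℤ) (t : ℝ) :
    (1 + ε₀) ^ ((5 : ℝ) * n / 2) * ∑ i, ∑ j, α i i j (0, 0, 1) * X i n t ^ 2 * X j (n + 1) t =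
      (1 + ε₀) ^ ((5 : ℝ) * (((n + 1 : ℤ) : ℝ) - 1) / 2) *
        ∑ j, ∑ i, α i i j (0, 0, 1) * X i ((n + 1) - 1) t ^ 2 * X j (n + 1) t := by
  rw [Finset.sum_comm]
  push_cast
  simp only [add_sub_cancel_right]

end Summit.NavierStokesRegularity.NavierStokesRegularity.Theorems

end
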